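import Summits.HodgeConjecture.HodgeConjecture.Theorems.TropicalWeilObstructionTropicalHodgeBoundCheckerEquations

/-!
# Crux `TropicalHodgeBound` (stmt-HodgeConjecture-18480), stub 4 — part C5b: from increasing pairs to all
# pairs — the three classes as alternating integer functions

Route `TropicalWeilObstruction` of `HodgeConjecture`, registered line `birth`
(`Cruxes/TropicalHodgeBound/Lines/birth.lean`), stub `stub_rationalHodgeCoordinates`; ingredient (C).

The certificate (`…Certificate`) pins an alternating integer table `y` down on INCREASING word pairs:
`yvOf y u = relRHS (yvOf y) u` for `u < 4900`. This file extends that to ALL word pairs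
(`y_eq_classes_of_rel`): `y I J = (y₀ + y₁₄) · θ̃(I,J) - y₁₄ · Re w̃(I,J) - y₄ · Im w̃(I,J)` with the
bi-alternating integer versions `thetaZ` (`det [I a = J b]`) and `wG I J = det Ω[I,·] · det Ω[J,·]`
(Gaussian integers) of the classes `θ₄`, `w`; both sides are bi-alternating and agree on increasing pairs
(decided bridges `theta_bridge`, `omega_bridge` to the checker's `basisN`). Also: the explicit
determinant `det4R` is `Matrix.det`. No named fact, no sorry.

References: [Zharkov2020TropicalWeil] I. Zharkov, arXiv:2002.02347, §2.
-/

set_option linter.dupNamespace false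

namespace Summit.HodgeConjecture.HodgeConjecture.Theorems.TropicalHodgeBound

open Literature.AlgebraicGeometry.Tropical

namespace Chk

/-! ### `det4R` is the determinant -/

/-- `det4R` is the determinant. [folklore] -/
theorem det4R_eq_det {R : Type*} [CommRing R] (M : Fin 4 → Fin 4 → R) : det4R M = (Matrix.of M).det := by
  rw [Matrix.det_succ_row_zero, Fin.sum_univ_four]
  simp only [Matrix.det_fin_three, Matrix.submatrix_apply, Matrix.of_apply, det4R, det3R]
  norm_num
  ring

/-! ### The classes on all word pairs -/

/-- `θ̃(I, J) = det [I a = J b]_{a,b}`: the bi-alternating integer coordinates of `θ₄` (`[I = J]` on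
increasing pairs). [cite: Zharkov2020TropicalWeil, §2] -/
def thetaZ (I J : Fin 4 → Fin (2 * 4)) : ℤ := det4R fun a b => if I a = J b then 1 else 0

/-- The Gaussian-integer minor `det Ω[I, ·]` of Zharkov's frame, on words. [cite: Zharkov2020TropicalWeil, §2] -/
def omegaMinorF (I : Fin 4 → Fin (2 * 4)) : GaussianInt := det4R fun a b => omegaN (I a) b

/-- `w̃(I, J) = det Ω[I,·] · det Ω[J,·]`: the bi-alternating Gaussian-integer coordinates of `w`.
[cite: Zharkov2020TropicalWeil, §2] -/
def wG (I J : Fin 4 → Fin (2 * 4)) : GaussianInt := omegaMinorF I * omegaMinorF J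

/-- `thetaZ` is alternating in the first word. [folklore] -/
theorem thetaZ_perm_left (I J : Fin 4 → Fin (2 * 4)) (τ : Equiv.Perm (Fin 4)) :
    thetaZ (I ∘ τ) J = ((Equiv.Perm.sign τ : ℤˣ) : ℤ) * thetaZ I J := by
  unfold thetaZ
  rw [det4R_eq_det, det4R_eq_det]
  have : (Matrix.of fun a b => if (I ∘ τ) a = J b then (1 : ℤ) else 0) =
      (Matrix.of fun a b => if I a = J b then (1 : ℤ) else 0).submatrix τ id := by
    ext a b; simp
  rw [this, Matrix.det_permute]
  simp

/-- `thetaZ` is alternating in the second word. [folklore] -/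
theorem thetaZ_perm_right (I J : Fin 4 → Fin (2 * 4)) (τ : Equiv.Perm (Fin 4)) :
    thetaZ I (J ∘ τ) = ((Equiv.Perm.sign τ : ℤˣ) : ℤ) * thetaZ I J := by
  unfold thetaZ
  rw [det4R_eq_det, det4R_eq_det]
  have : (Matrix.of fun a b => if I a = (J ∘ τ) b then (1 : ℤ) else 0) =
      (Matrix.of fun a b => if I a = J b then (1 : ℤ) else 0).submatrix id τ := by
    ext a b; simp
  rw [this, Matrix.det_permute']
  simp

/-- `omegaMinorF` is alternating. [folklore] -/
theorem omegaMinorF_perm (I : Fin 4 → Fin (2 * 4)) (τ : Equiv.Perm (Fin 4)) :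
    omegaMinorF (I ∘ τ) = ((Equiv.Perm.sign τ : ℤˣ) : ℤ) * omegaMinorF I := by
  unfold omegaMinorF
  rw [det4R_eq_det, det4R_eq_det]
  have : (Matrix.of fun (a : Fin 4) (b : Fin 4) => omegaN ((I ∘ τ) a) b) =
      (Matrix.of fun (a : Fin 4) (b : Fin 4) => omegaN (I a) b).submatrix τ id :=
    Matrix.ext fun _ _ => rfl
  rw [this, Matrix.det_permute]

/-- Real part of an integer multiple. [folklore] -/
theorem re_intCast_mul (s : ℤ) (z : GaussianInt) : ((s : GaussianInt) * z).re = s * z.re := by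
  simp [Zsqrtd.re_mul, Zsqrtd.re_intCast, Zsqrtd.im_intCast]

/-- Imaginary part of an integer multiple. [folklore] -/
theorem im_intCast_mul (s : ℤ) (z : GaussianInt) : ((s : GaussianInt) * z).im = s * z.im := by
  simp [Zsqrtd.im_mul, Zsqrtd.re_intCast, Zsqrtd.im_intCast]

/-- The combination `F = A θ̃ - B Re w̃ - C Im w̃` is alternating in the first word. [folklore] -/
theorem classes_perm_left (A B C : ℤ) (I J : Fin 4 → Fin (2 * 4)) (τ : Equiv.Perm (Fin 4)) :
    A * thetaZ (I ∘ τ) J - B * (wG (I ∘ τ) J).re - C * (wG (I ∘ τ) J).im =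
      ((Equiv.Perm.sign τ : ℤˣ) : ℤ) * (A * thetaZ I J - B * (wG I J).re - C * (wG I J).im) := by
  unfold wG
  rw [thetaZ_perm_left, omegaMinorF_perm, mul_assoc, re_intCast_mul, im_intCast_mul]
  ring

/-- The combination `F` is alternating in the second word. [folklore] -/
theorem classes_perm_right (A B C : ℤ) (I J : Fin 4 → Fin (2 * 4)) (τ : Equiv.Perm (Fin 4)) :
    A * thetaZ I (J ∘ τ) - B * (wG I (J ∘ τ)).re - C * (wG I (J ∘ τ)).im =
      ((Equiv.Perm.sign τ : ℤˣ) : ℤ) * (A * thetaZ I J - B * (wG I J).re - C * (wG I J).im) := by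
  unfold wG
  rw [thetaZ_perm_right, omegaMinorF_perm,
    show omegaMinorF I * ((((Equiv.Perm.sign τ : ℤˣ) : ℤ) : GaussianInt) * omegaMinorF J) =
      (((Equiv.Perm.sign τ : ℤˣ) : ℤ) : GaussianInt) * (omegaMinorF I * omegaMinorF J) by ring,
    re_intCast_mul, im_intCast_mul]
  ring

/-! ### Decided bridges to the checker's `basisN` -/

/-- On increasing words the checker's `θ`-value is `thetaZ`. [folklore] -/
theorem theta_bridge : ∀ i j : Fin 70,
    (basisN (sortedWords.getD i []) (sortedWords.getD j [])).1 = thetaZ (wordOfRank i) (wordOfRank j) := by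
  decide +kernel

/-- On increasing words the checker's `Ω`-minor is `omegaMinorF`. [folklore] -/
theorem omega_bridge : ∀ i : Fin 70,
    (omegaMinorN (sortedWords.getD i [])).re = (omegaMinorF (wordOfRank i)).re ∧
      (omegaMinorN (sortedWords.getD i [])).im = (omegaMinorF (wordOfRank i)).im := by
  decide +kernel

/-- On increasing words the checker's `Ω`-minor is `omegaMinorF` (as Gaussian integers). [folklore] -/
theorem omegaMinorN_eq (i : Fin 70) : omegaMinorN (sortedWords.getD i []) = omegaMinorF (wordOfRank i) :=
  Zsqrtd.ext (omega_bridge i).1 (omega_bridge i).2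

/-- `relRHS` in terms of the classes, for `u = 70 i + j`. [folklore] -/
theorem relRHS_eq (yv : ℕ → ℤ) (i j : Fin 70) :
    relRHS yv (70 * i + j) = (yv 0 + yv 14) * thetaZ (wordOfRank i) (wordOfRank j) -
      yv 14 * (wG (wordOfRank i) (wordOfRank j)).re - yv 4 * (wG (wordOfRank i) (wordOfRank j)).im := by
  have hi : (70 * (i : ℕ) + j) / 70 = i := by have := j.isLt; omega
  have hj : (70 * (i : ℕ) + j) % 70 = j := by have := j.isLt; omega
  unfold relRHS
  rw [hi, hj, theta_bridge i j]
  unfold basisN wG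
  simp only
  rw [omegaMinorN_eq i, omegaMinorN_eq j]
  ring

/-! ### Extension to all word pairs -/

/-- **From increasing pairs to all pairs.** If the alternating table `y` satisfies the resolved
relations on all unknown codes `< 4900`, then on every word pair
`y I J = (y₀ + y₁₄) θ̃(I,J) - y₁₄ Re w̃(I,J) - y₄ Im w̃(I,J)`. [cite: Zharkov2020TropicalWeil, §2] -/
theorem y_eq_classes_of_rel (y : (Fin 4 → Fin (2 * 4)) → (Fin 4 → Fin (2 * 4)) → ℤ)
    (hyI : ∀ (c d : Fin 4 → Fin (2 * 4)) (τ : Equiv.Perm (Fin 4)),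
      y (c ∘ τ) d = ((Equiv.Perm.sign τ : ℤˣ) : ℤ) * y c d)
    (hyJ : ∀ (c d : Fin 4 → Fin (2 * 4)) (τ : Equiv.Perm (Fin 4)),
      y c (d ∘ τ) = ((Equiv.Perm.sign τ : ℤˣ) : ℤ) * y c d)
    (hrel : ∀ u < 4900, yvOf y u = relRHS (yvOf y) u) (I J : Fin 4 → Fin (2 * 4)) :
    y I J = (yvOf y 0 + yvOf y 14) * thetaZ I J - yvOf y 14 * (wG I J).re - yvOf y 4 * (wG I J).im := by
  -- the right-hand side as an alternating table `F`
  let F : (Fin 4 → Fin (2 * 4)) → (Fin 4 → Fin (2 * 4)) → ℤ :=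
    fun I J => (yvOf y 0 + yvOf y 14) * thetaZ I J - yvOf y 14 * (wG I J).re - yvOf y 4 * (wG I J).im
  have hFI : ∀ (c d : Fin 4 → Fin (2 * 4)) (τ : Equiv.Perm (Fin 4)),
      F (c ∘ τ) d = ((Equiv.Perm.sign τ : ℤˣ) : ℤ) * F c d :=
    fun c d τ => classes_perm_left _ _ _ c d τ
  have hFJ : ∀ (c d : Fin 4 → Fin (2 * 4)) (τ : Equiv.Perm (Fin 4)),
      F c (d ∘ τ) = ((Equiv.Perm.sign τ : ℤˣ) : ℤ) * F c d :=
    fun c d τ => classes_perm_right _ _ _ c d τ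
  show y I J = F I J
  -- value functions
  have hc : ∀ a : Fin 4, fn4 (I 0 : ℕ) (I 1 : ℕ) (I 2 : ℕ) (I 3 : ℕ) a = (I a : ℕ) := by
    intro a; fin_cases a <;> rfl
  have hd : ∀ a : Fin 4, fn4 (J 0 : ℕ) (J 1 : ℕ) (J 2 : ℕ) (J 3 : ℕ) a = (J a : ℕ) := by
    intro a; fin_cases a <;> rfl
  have hc0 : fn4 (I 0 : ℕ) (I 1 : ℕ) (I 2 : ℕ) (I 3 : ℕ) 0 = (I 0 : ℕ) := hc 0
  have hc1 : fn4 (I 0 : ℕ) (I 1 : ℕ) (I 2 : ℕ) (I 3 : ℕ) 1 = (I 1 : ℕ) := hc 1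
  have hc2 : fn4 (I 0 : ℕ) (I 1 : ℕ) (I 2 : ℕ) (I 3 : ℕ) 2 = (I 2 : ℕ) := hc 2
  have hc3 : fn4 (I 0 : ℕ) (I 1 : ℕ) (I 2 : ℕ) (I 3 : ℕ) 3 = (I 3 : ℕ) := hc 3
  have hd0 : fn4 (J 0 : ℕ) (J 1 : ℕ) (J 2 : ℕ) (J 3 : ℕ) 0 = (J 0 : ℕ) := hd 0
  have hd1 : fn4 (J 0 : ℕ) (J 1 : ℕ) (J 2 : ℕ) (J 3 : ℕ) 1 = (J 1 : ℕ) := hd 1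
  have hd2 : fn4 (J 0 : ℕ) (J 1 : ℕ) (J 2 : ℕ) (J 3 : ℕ) 2 = (J 2 : ℕ) := hd 2
  have hd3 : fn4 (J 0 : ℕ) (J 1 : ℕ) (J 2 : ℕ) (J 3 : ℕ) 3 = (J 3 : ℕ) := hd 3
  by_cases hci : inj4 (fn4 (I 0 : ℕ) (I 1 : ℕ) (I 2 : ℕ) (I 3 : ℕ)) = true
  · by_cases hdi : inj4 (fn4 (J 0 : ℕ) (J 1 : ℕ) (J 2 : ℕ) (J 3 : ℕ)) = true
    · rw [y_eq_transport y hyI hyJ I J _ _ hc hd hci hdi, y_eq_transport F hFI hFJ I J _ _ hc hd hci hdi]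
      congr 1
      -- both valuations agree at the (in-range) unknown code
      have hci' : I 0 ≠ I 1 ∧ I 0 ≠ I 2 ∧ I 0 ≠ I 3 ∧ I 1 ≠ I 2 ∧ I 1 ≠ I 3 ∧ I 2 ≠ I 3 := by
        unfold inj4 at hci; rw [decide_eq_true_eq] at hci
        rw [hc0, hc1, hc2, hc3] at hci
        refine ⟨?_, ?_, ?_, ?_, ?_, ?_⟩ <;> intro h <;> simp_all
      have hdi' : J 0 ≠ J 1 ∧ J 0 ≠ J 2 ∧ J 0 ≠ J 3 ∧ J 1 ≠ J 2 ∧ J 1 ≠ J 3 ∧ J 2 ≠ J 3 := by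
        unfold inj4 at hdi; rw [decide_eq_true_eq] at hdi
        rw [hd0, hd1, hd2, hd3] at hdi
        refine ⟨?_, ?_, ?_, ?_, ?_, ?_⟩ <;> intro h <;> simp_all
      obtain ⟨-, -, hrI⟩ := sort_bridge (I 0) (I 1) (I 2) (I 3) hci'
      obtain ⟨-, -, hrJ⟩ := sort_bridge (J 0) (J 1) (J 2) (J 3) hdi'
      have hsI : sortedL (fn4 (I 0 : ℕ) (I 1 : ℕ) (I 2 : ℕ) (I 3 : ℕ)) = sort4 (I 0) (I 1) (I 2) (I 3) := by
        unfold sortedL; rw [hc0, hc1, hc2, hc3]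
      have hsJ : sortedL (fn4 (J 0 : ℕ) (J 1 : ℕ) (J 2 : ℕ) (J 3 : ℕ)) = sort4 (J 0) (J 1) (J 2) (J 3) := by
        unfold sortedL; rw [hd0, hd1, hd2, hd3]
      unfold unkN
      rw [hsI, hsJ]
      have key := hrel (70 * rankL (sort4 (I 0) (I 1) (I 2) (I 3)) + rankL (sort4 (J 0) (J 1) (J 2) (J 3)))
        (by omega)
      rw [key]
      have e := relRHS_eq (yvOf y) ⟨_, hrI⟩ ⟨_, hrJ⟩
      rw [e]
      -- `yvOf F` at the same code
      have hi : (70 * rankL (sort4 (I 0 : ℕ) (I 1) (I 2) (I 3)) + rankL (sort4 (J 0 : ℕ) (J 1) (J 2) (J 3))) / 70 =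
          rankL (sort4 (I 0 : ℕ) (I 1) (I 2) (I 3)) := by omega
      have hj : (70 * rankL (sort4 (I 0 : ℕ) (I 1) (I 2) (I 3)) + rankL (sort4 (J 0 : ℕ) (J 1) (J 2) (J 3))) % 70 =
          rankL (sort4 (J 0 : ℕ) (J 1) (J 2) (J 3)) := by omega
      show _ = F (wordOfRank ((70 * rankL (sort4 (I 0 : ℕ) (I 1) (I 2) (I 3)) +
          rankL (sort4 (J 0 : ℕ) (J 1) (J 2) (J 3))) / 70))
        (wordOfRank ((70 * rankL (sort4 (I 0 : ℕ) (I 1) (I 2) (I 3)) +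
          rankL (sort4 (J 0 : ℕ) (J 1) (J 2) (J 3))) % 70))
      rw [hi, hj]
    · obtain ⟨i, j, hij, hij'⟩ := exists_eq_of_inj4 J _ hd hdi
      have h1 : y I J = 0 := by
        have := y_eq_zero_of_eq (fun d' c' => y c' d') (fun d' c' τ => hyJ c' d' τ) J I i j hij hij'
        simpa using this
      have h2 : F I J = 0 := by
        have := y_eq_zero_of_eq (fun d' c' => F c' d') (fun d' c' τ => hFJ c' d' τ) J I i j hij hij'
        simpa using this
      rw [h1, h2]
  · obtain ⟨i, j, hij, hij'⟩ := exists_eq_of_inj4 I _ hc hci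
    rw [y_eq_zero_of_eq y hyI I J i j hij hij', y_eq_zero_of_eq F hFI I J i j hij hij']

end Chk

end Summit.HodgeConjecture.HodgeConjecture.Theorems.TropicalHodgeBound
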